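import Mathlib
import Literature.NumberTheory.LFunctions.Zhang2022.TypedSection17Rel
import Literature.NumberTheory.LFunctions.Zhang2022.Section18DefsE
import HarnessLib

/-!
# Zhang (2022) §17 (17.8)→(17.9): the `𝔢₁`-carrying displays of the `I₄⁻` chain PARAMETRISED over the
# value of `e″₁ⱼ` (RT-05 E-twins `…E e1pp`, ZHANG-L ruling R-28; rows G-L4t10-1 / G-num2-1 /
# D-G-num2-1), in the readings of record (relative budget D-G-L4fam-1; χ-twisted coefficients RT16-int-1)

Topic `Literature/NumberTheory/LFunctions/Zhang2022` (Landau–Siegel audit tree; verdict-neutral).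
Y. Zhang, *Discrete mean estimates and the Landau–Siegel zero*, arXiv:2211.02515v1 (2022)
[Zhang2022LandauSiegel] — **an unrefereed manuscript under adjudication. Every `def … : Prop` below is a
CLAIM of the manuscript (a display of §17 pp. 98–99) in a READING OF RECORD of the ZHANG-L lane, STATED
NOT ASSERTED; nothing here asserts or denies Theorems 1–2 of the source or says anything about
Landau–Siegel zeros.** Companion of `TypedSection17` / `TypedSection17Rel` (objects `Phi3minus`,
`nuOneStar`, `varrho17`, `kappa2bar`, `I4`, `nu`, `frakA`, `frakP`, … used BY NAME) and of `Section18DefsE`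
(`frakeE e1pp j`, `frake = frakeE e1ppj` by `rfl`).

WHY (numbers). (i) RT-05 (zl-lead R-22/R-28): `𝔢₁ = frake 1` enters §17 at u023/u024 ("by Lemma 15.1") and
is carried to u025, u026, (17.9); Appendix B DERIVES `e″₁ⱼ = −jπi·b*` (`AppendixB.e1ppD_eq`), not the value
stated in Lemma 15.1/(B.3) (`Section18Defs.e1ppj`; kernel `Numerics.not_StepB_u015c`,
`Numerics.appB3_chain_inconsistent`), so the chain is carried at the parameter `e1pp` and instantiated at
`AppendixB.e1ppD`. (ii) D-G-L4fam-1 (relative reading of record): below (17.9) sits the unprinted summed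
error of u024 (row G-d58-1), whose budget is `ε(𝔞+1)` (`TypedSection17Rel`). (iii) RT16-int-1 (WP16-PLAN
v0.4 §1.6, R-20, referee countersign zl-w16-ref-2 2026-08-26T23:34Z): `B(s,ψ) = Σ b(n)ψχ(n)n^{−s}` (15.1),
so the honest `ψ`-coefficients of `B·G·N(s+β₂)N(s+β₃)` are `(bχ) ∗ ν₁*`
(`LSeries.convolution (fun n => bcoef D n * χ n) (nuOneStar c′ χ)`), not the χ-free `bConvNuOne` of the
printed-literal nodes `Step17_u015/Eq17_8/Step17_u019–u021/u023/u024` (never prover targets).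

What is here (statements only + `rfl` bridges; the edges are zl-w16-p3's, WP16-PLAN Sketch S4 at the
parameter): `Eq17_8Chi` (χ-twisted (17.8), 𝔢-free), `Step17_u021Chi` (χ-twisted u021, 𝔢-free),
`Step17_u024ChiRelE e1pp` (χ-twisted u024 in the relative budget, main term `𝔢₁[e1pp]·…`),
`Step17_u025E e1pp` (u025 verbatim at the parameter; `Step17_u025E e1ppj = Step17_u025`),
`Step17_u026RelE e1pp` (u026 in the relative budget at the parameter), `Eq17_9RelE e1pp` (the LEAF (17.9)ᴿ
at the parameter; `Eq17_9RelE e1ppj = Eq17_9Rel`; skeleton binder of record `Eq17_9RelE AppendixB.e1ppD c′`).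
No instance, no notation; printed decls untouched.

## References

* Y. Zhang, arXiv:2211.02515v1 (2022), §17 pp. 97–99, (17.8)–(17.9), tex L4811–L4849; §15 (15.1),
  Lemma 15.1 p. 86; App. B (B.3). [cite: Zhang2022LandauSiegel, §17 (17.8)–(17.9) pp.98–99]
-/

noncomputable section

open Complex Real ComplexConjugate
open Literature.NumberTheory.LFunctions.Zhang2022
open Literature.NumberTheory.LFunctions.Zhang2022.Skeleton

namespace Literature.NumberTheory.LFunctions.Zhang2022.Typed.Section17

/-! ## The χ-twisted, 𝔢-free inputs (RT16-int-1; texts = WP16-PLAN Sketch S4 hypotheses verbatim) -/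

/-- **(17.8) in the χ-twisted reading** (tex L4813; RT16-int-1): "`Φ₃⁻(p) = pΣ_n ((bχ)∗ν₁*)(n)ϱ*(n)/n +
o(p)`", uniformly in `p ∼ P` — `Eq17_8` with the honest coefficient `(bχ)∗ν₁*` of `B·G·N·N` ((15.1)) in
place of the printed χ-free `b∗ν₁*`; = hypothesis `h8` of Sketch S4 `eq17_9Rel_of_partsChiRel`. NOT PRINTED
in this form. CLAIM. [cite: Zhang2022LandauSiegel, §17 (17.8) p.98] -/
def Eq17_8Chi (c' : ℝ) : Prop :=
  ∀ ε : ℝ, 0 < ε → ForAllLarge fun D _ χ => AssumptionA D χ → ∀ p ∈ primeWindow D,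
    ‖Phi3minus c' χ p - (p : ℂ) *
        ∑' n : ℕ, LSeries.convolution (fun n => bcoef D n * χ (n : ZMod D)) (nuOneStar c' χ) n *
          varrho17 c' χ n / (n : ℂ)‖ ≤ ε * p

/-- **u021 in the χ-twisted reading** (tex L4825; RT16-int-1): "`Σ_n ((bχ)∗ν₁*)(n)ϱ*(n)/n =
Σ_{l<D⁴}(ν(l)/l)Σ_{l=l₁l₂}Σ_{(m₁,𝔮)=1} b(l₁m₁)χ(l₁m₁)ν₁*(l₂)κ̄₂(m₁)/m₁ + o(1)`"; = hypothesis `h21` of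
Sketch S4 `step17_u024ChiRel_of_lemma151Chi`. NOT PRINTED in this form. CLAIM.
[cite: Zhang2022LandauSiegel, §17 u021 p.98] -/
def Step17_u021Chi (c' : ℝ) : Prop :=
  ∀ ε : ℝ, 0 < ε → ForAllLarge fun D _ χ => AssumptionA D χ →
    ‖(∑' n : ℕ, LSeries.convolution (fun n => bcoef D n * χ (n : ZMod D)) (nuOneStar c' χ) n *
          varrho17 c' χ n / (n : ℂ)) -
        ∑ l ∈ Finset.Ico 1 (D ^ 4), nu χ l / (l : ℂ) *
          ∑ q ∈ l.divisorsAntidiagonal, ∑' m₁ : ℕ,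
            if Nat.Coprime m₁ (frakq D) then
              bcoef D (q.1 * m₁) * χ ((q.1 * m₁ : ℕ) : ZMod D) * nuOneStar c' χ q.2 *
                kappa2bar c' D m₁ / (m₁ : ℂ)
            else 0‖ ≤ ε

/-! ## The `𝔢₁`-carrying displays at the parameter `e1pp` (RT-05 E-twins) -/

/-- **u024, χ-twisted, relative budget, at the parameter `e″ = e1pp`** (tex L4837; RT16-int-1 ×
D-G-L4fam-1 × RT-05): "`Σ_n ((bχ)∗ν₁*)(n)ϱ*(n)/n = 𝔢₁[e1pp] Σ_{l<D⁴}(ν(l)/l)Σ_{l=l₁l₂}χ(l₁)τ₂(l₁)ν₁*(l₂)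
+ o(𝔞+1)`" (`𝔢₁[e1pp] = frakeE e1pp 1`); at `e1pp = e1ppj` this is the conclusion of Sketch S4
`step17_u024ChiRel_of_lemma151Chi` verbatim (`step17_u024ChiRelE_e1ppj`). Instance of record `e1pp =
AppendixB.e1ppD` (DERIVED `e″₁ⱼ = −jπi·b*`, rows G-L4t10-1 / G-num2-1 / D-G-num2-1). NOT PRINTED. CLAIM.
[cite: Zhang2022LandauSiegel, §17 u024 p.98] -/
def Step17_u024ChiRelE (e1pp : ℕ → ℂ) (c' : ℝ) : Prop :=
  ∀ ε : ℝ, 0 < ε → ForAllLarge fun D _ χ => AssumptionA D χ →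
    ‖(∑' n : ℕ, LSeries.convolution (fun n => bcoef D n * χ (n : ZMod D)) (nuOneStar c' χ) n *
          varrho17 c' χ n / (n : ℂ)) -
        frakeE e1pp 1 * ∑ l ∈ Finset.Ico 1 (D ^ 4), nu χ l / (l : ℂ) *
          ∑ q ∈ l.divisorsAntidiagonal,
            χ (q.1 : ZMod D) * (q.1.divisors.card : ℂ) * nuOneStar c' χ q.2‖ ≤
      ε * (frakA χ + 1)

/-- **u025 at the parameter `e″ = e1pp`** (tex L4841): "the right side [of u024] is equal to
`𝔢₁Σ_{l<D⁴}ν(l)²/l + o(1) = 𝔢₁𝔞 + o(1)`" — `Step17_u025` verbatim with `𝔢₁ ↦ 𝔢₁[e1pp]` (both printed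
equalities; the second is `|𝔢₁[e1pp]|` times Lemma 17.1, a tree theorem). `Step17_u025E e1ppj = Step17_u025`
(`rfl`). RT-05 rows G-L4t10-1 / G-num2-1 / D-G-num2-1. CLAIM. [cite: Zhang2022LandauSiegel, §17 u025 p.98] -/
def Step17_u025E (e1pp : ℕ → ℂ) (c' : ℝ) : Prop :=
  ∀ ε : ℝ, 0 < ε → ForAllLarge fun D _ χ => AssumptionA D χ →
    ‖frakeE e1pp 1 * (∑ l ∈ Finset.Ico 1 (D ^ 4), nu χ l / (l : ℂ) *
          ∑ q ∈ l.divisorsAntidiagonal,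
            χ (q.1 : ZMod D) * (q.1.divisors.card : ℂ) * nuOneStar c' χ q.2) -
        frakeE e1pp 1 * ∑ l ∈ Finset.Ico 1 (D ^ 4), nu χ l ^ 2 / (l : ℂ)‖ ≤ ε ∧
    ‖frakeE e1pp 1 * (∑ l ∈ Finset.Ico 1 (D ^ 4), nu χ l ^ 2 / (l : ℂ)) -
        frakeE e1pp 1 * frakA χ‖ ≤ ε

/-- **u026 in the relative budget, at the parameter `e″ = e1pp`** (tex L4845; D-G-L4fam-1 × RT-05):
"`Φ₃⁻(p) = 𝔢₁[e1pp]𝔞p + o((𝔞+1)p)`", uniformly in `p ∼ P` — `Step17_u026` with `𝔢₁ ↦ 𝔢₁[e1pp]` and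
`o(p)` read `ε(𝔞+1)p`. NOT PRINTED in this form; RT-05 rows G-L4t10-1 / G-num2-1 / D-G-num2-1. CLAIM.
[cite: Zhang2022LandauSiegel, §17 u026 p.98] -/
def Step17_u026RelE (e1pp : ℕ → ℂ) (c' : ℝ) : Prop :=
  ∀ ε : ℝ, 0 < ε → ForAllLarge fun D _ χ => AssumptionA D χ → ∀ p ∈ primeWindow D,
    ‖Phi3minus c' χ p - frakeE e1pp 1 * frakA χ * (p : ℂ)‖ ≤ ε * (frakA χ + 1) * p

/-- **(17.9)ᴿ at the parameter `e″ = e1pp`** (tex L4849; E-twin of the LEAF `Typed.Section17.Eq17_9Rel`,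
R-28 C2 — the skeleton binder of record becomes `Eq17_9RelE AppendixB.e1ppD c′`):
"`Σ_{ψ∈Ψ₁}(p_ψt₀)^{β₃}I₄⁻(ψ) = 𝔢₁[e1pp]𝔞𝔓 + o((𝔞+1)𝔓)`". `Eq17_9RelE e1ppj = Eq17_9Rel` (`rfl`); at
`e1pp = AppendixB.e1ppD` this is (17.9) with the DERIVED constant `e″₁ⱼ = −jπi·b*` (App. B's own computation),
NOT the value stated in Lemma 15.1/(B.3) (rows G-L4t10-1 / G-num2-1 / D-G-num2-1, RT-05). CLAIM.
[cite: Zhang2022LandauSiegel, §17 (17.9) p.98] -/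
def Eq17_9RelE (e1pp : ℕ → ℂ) (c' : ℝ) : Prop :=
  ∀ ε : ℝ, 0 < ε → ForAllLarge fun D _ χ => AssumptionA D χ →
    ‖(∑ x ∈ finsetOf (PsiOne χ), (((x.p : ℝ) * t0 D : ℝ) : ℂ) ^ beta3 c' D * I4 c' χ x (-alpha D)) -
        frakeE e1pp 1 * frakA χ * frakP D‖ ≤ ε * (frakA χ + 1) * frakP D

/-! ## `rfl` bridges to the stated-constant instances -/

/-- `Step17_u025E e1ppj = Step17_u025` (stated `e″`). [cite: Zhang2022LandauSiegel, §17 u025 p.98] -/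
theorem step17_u025E_e1ppj (c' : ℝ) : Step17_u025E e1ppj c' = Step17_u025 c' := rfl

/-- `Eq17_9RelE e1ppj = Eq17_9Rel` (stated `e″`; the v19–v23 leaf).
[cite: Zhang2022LandauSiegel, §17 (17.9) p.98] -/
theorem eq17_9RelE_e1ppj (c' : ℝ) : Eq17_9RelE e1ppj c' = Eq17_9Rel c' := rfl

/-- `Step17_u024ChiRelE e1ppj` is literally the conclusion of WP16-PLAN Sketch S4
`step17_u024ChiRel_of_lemma151Chi` (stated `e″`; unfolding `frakeE e1ppj = frake`).
[cite: Zhang2022LandauSiegel, §17 u024 p.98] -/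
theorem step17_u024ChiRelE_e1ppj_iff (c' : ℝ) : Step17_u024ChiRelE e1ppj c' ↔
    ∀ ε : ℝ, 0 < ε → ForAllLarge fun D _ χ => AssumptionA D χ →
      ‖(∑' n : ℕ, LSeries.convolution (fun n => bcoef D n * χ (n : ZMod D)) (nuOneStar c' χ) n *
            varrho17 c' χ n / (n : ℂ)) -
          frake 1 * ∑ l ∈ Finset.Ico 1 (D ^ 4), nu χ l / (l : ℂ) *
            ∑ q ∈ l.divisorsAntidiagonal,
              χ (q.1 : ZMod D) * (q.1.divisors.card : ℂ) * nuOneStar c' χ q.2‖ ≤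
        ε * (frakA χ + 1) := Iff.rfl

/-- `Step17_u026RelE e1ppj` unfolded at the stated `e″` (the relative u026 with `frake 1`).
[cite: Zhang2022LandauSiegel, §17 u026 p.98] -/
theorem step17_u026RelE_e1ppj_iff (c' : ℝ) : Step17_u026RelE e1ppj c' ↔
    ∀ ε : ℝ, 0 < ε → ForAllLarge fun D _ χ => AssumptionA D χ → ∀ p ∈ primeWindow D,
      ‖Phi3minus c' χ p - frake 1 * frakA χ * (p : ℂ)‖ ≤ ε * (frakA χ + 1) * p := Iff.rfl

end Literature.NumberTheory.LFunctions.Zhang2022.Typed.Section17
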